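import Literature.AlgebraicGeometry.HodgeTheory.DworkSexticJacobianInvariantLineInjective
import Literature.AlgebraicGeometry.Motives.DworkFamily
import Mathlib.RingTheory.IntegralDomain
import HarnessLib

/-!
# Averaging a sextic-fourfold polynomial over Katz's group `Γ_W`: the Reynolds operator lands on the
# balanced part

Family `hodge`, layer `Literature/AlgebraicGeometry/HodgeTheory` (namespace `DworkSextic`); theorems only.
Written for the crux `GenericInvariantHodgeClasses` (stmt-HodgeConjecture-24129) of route
`HodgeConjecture/DworkReflectionQuotients` (the step "a `Γ_W`-invariant class of `R_F` is represented by a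
`Γ_W`-invariant = balanced polynomial" of the infinitesimal Noether–Lefschetz climb on the invariant piece).

For `a ∈ Γ_W = {a ∈ μ₆⁶ : ∏ aᵢ = 1}` (`DworkSextic.gammaW`) and `P ∈ ℂ[x₀,…,x₅]`, write
`P∘a = P(a₀x₀, …, a₅x₅)` (`MvPolynomial.aeval (ProjectiveSpace.diagSubst a) P`). Then

* `aeval_diagSubst_monomial` — `x^m ∘ a = a^m · x^m`;
* `sum_gammaW_pow_eq` — the character sum `Σ_{a ∈ Γ_W} a^m` is `|Γ_W|` if `m` is balanced
  (`mᵢ ≡ m₀ mod 6`, the trivial character, `forall_unitWeight_eq_one_iff_balanced`) and `0` otherwise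
  (orthogonality, Mathlib `sum_hom_units_eq_zero`);
* **`sum_gammaW_aeval_diagSubst`** — `Σ_{a ∈ Γ_W} P∘a = |Γ_W| · P_bal`, where
  `P_bal = Σ_{m balanced} coeff_m(P) x^m` is the BALANCED PART of `P` (written as the explicit finite sum
  over the support); `support_balancedPart`, `isHomogeneous_balancedPart`: `P_bal` is supported on balanced
  exponents and is homogeneous of degree `k` if `P` is.

## References

* [Katz2009] N. M. Katz, Another look at the Dwork family, Progr. Math. 270 (2009), §2–§3 (the characters
  of `Γ_W`).
* [Serre1977] J.-P. Serre, Linear Representations of Finite Groups (1977), §2.3 (orthogonality of characters;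
  the projector `|G|⁻¹ Σ g`).
-/

noncomputable section

open MvPolynomial Finset
open scoped BigOperators

namespace Literature.AlgebraicGeometry.HodgeTheory.DworkSextic

open Literature.AlgebraicGeometry.Motives Literature.AlgebraicGeometry.Motives.UniversalHypersurface

/-! ### §1 Diagonal substitutions on monomials -/

/-- **`x^m ∘ a = (∏ aᵢ^{mᵢ}) · x^m`**: a diagonal substitution scales each monomial by its weight.
[cite: Katz2009, §3] -/
theorem aeval_diagSubst_monomial (a : Fin 6 → ℂ) (m : Fin 6 →₀ ℕ) (c : ℂ) :
    aeval (ProjectiveSpace.diagSubst a) (monomial m c) = monomial m (c * ∏ i, a i ^ m i) := by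
  rw [aeval_monomial, Finsupp.prod_fintype _ _ (fun i => pow_zero _)]
  have h : ∀ i, (ProjectiveSpace.diagSubst a i) ^ (m i) =
      C (a i ^ m i) * (X i : MvPolynomial (Fin 6) ℂ) ^ m i := fun i => by
    rw [ProjectiveSpace.diagSubst_apply, mul_pow, map_pow]
  simp_rw [h]
  rw [Finset.prod_mul_distrib, ← map_prod, algebraMap_eq, ← mul_assoc, ← map_mul, monomial_eq,
    Finsupp.prod_fintype _ _ (fun i => pow_zero _)]

/-- Coefficients under a diagonal substitution: `coeff_m(P∘a) = a^m · coeff_m(P)`. [cite: Katz2009, §3] -/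
theorem coeff_aeval_diagSubst (a : Fin 6 → ℂ) (P : MvPolynomial (Fin 6) ℂ) (m : Fin 6 →₀ ℕ) :
    coeff m (aeval (ProjectiveSpace.diagSubst a) P) = (∏ i, a i ^ m i) * coeff m P := by
  classical
  induction P using MvPolynomial.induction_on' with
  | monomial u c =>
    rw [aeval_diagSubst_monomial, coeff_monomial, coeff_monomial]
    split_ifs with h
    · rw [h]; ring
    · rw [mul_zero]
  | add p q hp hq => rw [map_add, coeff_add, coeff_add, hp, hq, mul_add]

/-! ### §2 The character sums of `Γ_W` -/

/-- **Orthogonality of the characters of `Γ_W`**: `Σ_{a ∈ Γ_W} ∏ aᵢ^{mᵢ} = |Γ_W|` if `m` is balanced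
(`a^m = 1` for all `a`, `forall_unitWeight_eq_one_iff_balanced`), and `= 0` otherwise (the sum of a
non-trivial character over a finite group vanishes). [cite: Serre1977, §2.3] [cite: Katz2009, §2 p. 5] -/
theorem sum_gammaW_pow_eq (m : Fin 6 →₀ ℕ) :
    ∑ a : gammaW, ∏ i, (((a : Fin (4 + 2) → ℂˣ) i : ℂˣ) : ℂ) ^ m i =
      if (∀ l : Fin 6, m l % 6 = m 0 % 6) then (Fintype.card gammaW : ℂ) else 0 := by
  have hw : ∀ a : Fin (4 + 2) → ℂˣ, ((unitWeight ℂ 4 a m : ℂˣ) : ℂ) = ∏ i, ((a i : ℂˣ) : ℂ) ^ m i := by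
    intro a
    rw [unitWeight_coe, Finsupp.prod_fintype _ _ (fun i => pow_zero _)]
  split_ifs with hbal
  · have h1 : ∀ a : gammaW, ∏ i, (((a : Fin (4 + 2) → ℂˣ) i : ℂˣ) : ℂ) ^ m i = 1 := fun a => by
      rw [← hw, (forall_unitWeight_eq_one_iff_balanced m).mpr hbal a, Units.val_one]
    simp only [h1, Finset.sum_const, Finset.card_univ, nsmul_eq_mul, mul_one]
  · -- the character `a ↦ a^m` is non-trivial
    have hne : (Units.coeHom ℂ).comp (character (⇑m)) ≠ 1 := by
      intro h
      apply hbal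
      refine (forall_unitWeight_eq_one_iff_balanced m).mp fun a => Units.val_injective ?_
      have ha := DFunLike.congr_fun h a
      rw [MonoidHom.comp_apply, Units.coeHom_apply, character_apply_val, MonoidHom.one_apply] at ha
      rw [hw, ha, Units.val_one]
    have h0 := sum_hom_units_eq_zero ((Units.coeHom ℂ).comp (character (⇑m))) hne
    simpa only [MonoidHom.comp_apply, Units.coeHom_apply, character_apply_val] using h0

/-! ### §3 The Reynolds operator lands on the balanced part -/

/-- **`Σ_{a ∈ Γ_W} P∘a = |Γ_W| · P_bal`**, `P_bal = Σ_{m ∈ supp P, m balanced} coeff_m(P) x^m` the balanced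
part of `P` (the Reynolds projector of `Γ_W` on polynomials, computed monomial by monomial with the
orthogonality `sum_gammaW_pow_eq`). [cite: Serre1977, §2.3] [cite: Katz2009, §3] -/
theorem sum_gammaW_aeval_diagSubst (P : MvPolynomial (Fin 6) ℂ) :
    ∑ a : gammaW, aeval (ProjectiveSpace.diagSubst fun i => (((a : Fin (4 + 2) → ℂˣ) i : ℂˣ) : ℂ)) P =
      (Fintype.card gammaW : ℂ) •
        ∑ m ∈ P.support.filter (fun m => ∀ l : Fin 6, m l % 6 = m 0 % 6), monomial m (coeff m P) := by
  classical
  apply MvPolynomial.ext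
  intro m
  have hL : coeff m (∑ a : gammaW,
      aeval (ProjectiveSpace.diagSubst fun i => (((a : Fin (4 + 2) → ℂˣ) i : ℂˣ) : ℂ)) P) =
      (∑ a : gammaW, ∏ i, (((a : Fin (4 + 2) → ℂˣ) i : ℂˣ) : ℂ) ^ m i) * coeff m P := by
    rw [coeff_sum, Finset.sum_mul]
    exact Finset.sum_congr rfl fun a _ => coeff_aeval_diagSubst _ P m
  have hR : coeff m (∑ m' ∈ P.support.filter (fun m => ∀ l : Fin 6, m l % 6 = m 0 % 6),
      monomial m' (coeff m' P)) =
      if m ∈ P.support.filter (fun m => ∀ l : Fin 6, m l % 6 = m 0 % 6) then coeff m P else 0 := by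
    rw [coeff_sum, Finset.sum_congr rfl (fun m' _ => coeff_monomial m m' (coeff m' P)), Finset.sum_ite_eq']
  rw [hL, coeff_smul, hR, smul_eq_mul, sum_gammaW_pow_eq]
  by_cases hbal : ∀ l : Fin 6, m l % 6 = m 0 % 6
  · rw [if_pos hbal]
    by_cases hm : m ∈ P.support
    · rw [if_pos (Finset.mem_filter.mpr ⟨hm, hbal⟩)]
    · rw [if_neg (fun h => hm (Finset.mem_filter.mp h).1), notMem_support_iff.mp hm, mul_zero]
  · rw [if_neg hbal, zero_mul, if_neg (fun h => hbal (Finset.mem_filter.mp h).2), mul_zero]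

/-- The balanced part of `P` is supported on balanced exponents (inside the support of `P`).
[cite: Katz2009, §3] -/
theorem support_balancedPart_subset (P : MvPolynomial (Fin 6) ℂ) :
    ∀ e ∈ (∑ m ∈ P.support.filter (fun m => ∀ l : Fin 6, m l % 6 = m 0 % 6), monomial m (coeff m P)).support,
      (∀ l : Fin 6, e l % 6 = e 0 % 6) ∧ e ∈ P.support := by
  classical
  intro e he
  obtain ⟨m, hm, hem⟩ := Finset.mem_biUnion.mp (support_sum he)
  rw [Finset.mem_filter] at hm
  have : e = m := by
    by_contra hne
    rw [support_monomial] at hem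
    split_ifs at hem with h0
    · exact absurd hem (Finset.notMem_empty _)
    · exact hne (Finset.mem_singleton.mp hem)
  subst this
  exact ⟨hm.2, hm.1⟩

/-- **The balanced part of a form of degree `k` is supported on balanced exponents of degree `k`** — the
hypothesis shape of `DworkSextic.prod_X_mul_mem_jacobianIdeal_iff`. [cite: Katz2009, §3] -/
theorem balancedPart_support_degree {P : MvPolynomial (Fin 6) ℂ} {k : ℕ} (hP : P.IsHomogeneous k) :
    ∀ e ∈ (∑ m ∈ P.support.filter (fun m => ∀ l : Fin 6, m l % 6 = m 0 % 6), monomial m (coeff m P)).support,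
      (∀ l : Fin 6, e l % 6 = e 0 % 6) ∧ ∑ l : Fin 6, e l = k := by
  intro e he
  obtain ⟨hbal, hsupp⟩ := support_balancedPart_subset P e he
  refine ⟨hbal, ?_⟩
  have h := hP (mem_support_iff.mp hsupp)
  rw [← h, Finsupp.weight_apply, Finsupp.sum_fintype _ _ (fun i => by simp)]
  simp only [Pi.one_apply, smul_eq_mul, mul_one]

/-- The balanced part of a form of degree `k` is a form of degree `k` (the Reynolds projector preserves
degrees). [cite: Serre1977, §2.3] -/
theorem isHomogeneous_balancedPart {P : MvPolynomial (Fin 6) ℂ} {k : ℕ} (hP : P.IsHomogeneous k) :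
    (∑ m ∈ P.support.filter (fun m => ∀ l : Fin 6, m l % 6 = m 0 % 6), monomial m (coeff m P)).IsHomogeneous k := by
  classical
  refine IsHomogeneous.sum _ _ _ fun m hm => ?_
  rw [Finset.mem_filter] at hm
  by_cases hc : coeff m P = 0
  · rw [hc, monomial_zero]; exact isHomogeneous_zero _ _ _
  · exact isHomogeneous_monomial _ (by rw [Finsupp.degree_eq_weight_one]; exact hP hc)

end Literature.AlgebraicGeometry.HodgeTheory.DworkSextic

end
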